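import Mathlib.Algebra.Lie.Weights.RootSystem
import Mathlib.Algebra.Lie.CartanExists
import Mathlib.Algebra.Lie.CartanCriterion
import Mathlib.GroupTheory.Perm.Cycle.Type
import Mathlib.FieldTheory.IsAlgClosed.AlgebraicClosure
import Literature.Algebra.Lie.KillingBaseChange
import HarnessLib

/-!
# A semisimple Lie algebra has dimension `rank + #roots`, with `#roots` even and `≥ 2·rank`; hence its dimension is not `1, 2, 4, 5` or `7`

Topic `Literature/Algebra/Lie`. Theorems only (no definition, no named fact, D-0026), in Mathlib's vocabulary
(`LieAlgebra.IsKilling`, `LieSubalgebra.IsCartanSubalgebra`, `LieModule.Weight`, `LieAlgebra.rootSpace`,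
`LieSubalgebra.root = {α | α.IsNonZero}`). Written for the cell `pub-hodgecm2` (COR-CM), seat `b27` (count-neutral own
lane MT-REDUCTIVE): the «small-dimension table» for the semisimple part of the Hodge Lie algebra of an abelian variety
(`Summits/HodgeConjecture/CorCM/MumfordTateRankSix`).

PRINTED RESULT. J. E. Humphreys, *Introduction to Lie Algebras and Representation Theory*, GTM 9, §8.1 (root space
decomposition `L = H ⊕ ⨁_{α ∈ Φ} L_α` for a semisimple `L` over an algebraically closed field of characteristic `0`),
§8.3 Prop. (a) «`Φ` spans `H*`», (b) «if `α ∈ Φ` then `-α ∈ Φ`», §8.4 Prop. (a) «`dim L_α = 1`» and (b) «the only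
multiples of `α` in `Φ` are `±α`». The counting consequence `dim L = rank L + |Φ|`, `|Φ|` even, `|Φ| ≥ 2·rank L` and the
resulting exclusion of the dimensions `1, 2, 4, 5, 7` is folklore (the smallest semisimple Lie algebras have dimensions
`3, 6, 8, 9, 10, …`).

RESULTS (namespace `Literature.Algebra.Lie.SemisimpleSmallDimension`). Over an algebraically closed field `K` of
characteristic `0`, `L` finite-dimensional with non-degenerate Killing form, `H` a (splitting) Cartan subalgebra:
* `finrank_eq_finrank_cartan_add_card_root` — `dim L = dim H + #roots` (Mathlib's root space decomposition
  `LieModule.iSup_genWeightSpace_eq_top'` / `iSupIndep_genWeightSpace'`, `rootSpace_zero_eq`, `finrank_rootSpace_eq_one`);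
* `card_root_eq_zero_of_finrank_cartan_eq_zero`; `even_card_root` (`α ↦ -α` is a fixed-point-free involution);
  `two_mul_finrank_cartan_le_card_root` (the roots span `H*`, and a basis of roots is disjoint from its negative);
  `card_root_eq_two_of_finrank_cartan_eq_one` (`LieAlgebra.IsKilling.eq_neg_or_eq_of_eq_smul`: in rank one `Φ = {±α}`);
* **`finrank_ne_of_isKilling_of_isAlgClosed`** — `dim L ∉ {1, 2, 4, 5, 7}`;
* over ANY field of characteristic `0` (base change to the algebraic closure, `KillingBaseChange.isKilling_baseChange`):
  **`finrank_ne_of_isKilling`**, **`finrank_ne_of_hasTrivialRadical`** (Cartan's criterion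
  `LieAlgebra.HasTrivialRadical.instIsKilling`), `three_le_finrank_of_hasTrivialRadical` (a non-zero semisimple Lie
  algebra has dimension `≥ 3`, and dimension `≥ 6` unless it is `3`).

## References

* [Humphreys1972] J. E. Humphreys, *Introduction to Lie Algebras and Representation Theory*, GTM 9 (1972), §8.1,
  §8.3–§8.4.
-/

namespace Literature.Algebra.Lie

namespace SemisimpleSmallDimension

open LieAlgebra LieModule Module
open scoped TensorProduct

/-! ### §1 Over an algebraically closed field: the root count -/

section AlgClosed

variable {K L : Type*} [Field K] [CharZero K] [IsAlgClosed K] [LieRing L] [LieAlgebra K L]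
  [FiniteDimensional K L] [LieAlgebra.IsKilling K L]
  (H : LieSubalgebra K L) [H.IsCartanSubalgebra]

/-- **Root space decomposition, counted: `dim L = dim H + #roots`** (`L = H ⊕ ⨁_{α ≠ 0} L_α` with `dim L_α = 1`).
[cite: Humphreys1972, §8.1] [cite: Humphreys1972, §8.4] -/
theorem finrank_eq_finrank_cartan_add_card_root :
    finrank K L = finrank K H + H.root.card := by
  classical
  -- internal direct sum of the (generalised) root spaces
  have hind : iSupIndep fun α : Weight K H L => ((rootSpace H α : LieSubmodule K H L) : Submodule K L) :=
    LieSubmodule.iSupIndep_toSubmodule.2 (LieModule.iSupIndep_genWeightSpace' K H L)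
  have htop : ⨆ α : Weight K H L, ((rootSpace H α : LieSubmodule K H L) : Submodule K L) = ⊤ := by
    rw [← LieSubmodule.iSup_toSubmodule, LieModule.iSup_genWeightSpace_eq_top' K H L, LieSubmodule.top_toSubmodule]
  have hint : DirectSum.IsInternal fun α : Weight K H L => ((rootSpace H α : LieSubmodule K H L) : Submodule K L) :=
    DirectSum.isInternal_submodule_of_iSupIndep_of_iSup_eq_top hind htop
  have hsum : finrank K L = ∑ α : Weight K H L, finrank K (rootSpace H α) := by
    rw [← (LinearEquiv.ofBijective (DirectSum.coeLinearMap _) hint).finrank_eq, Module.finrank_directSum]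
    rfl
  rw [hsum, ← Finset.sum_filter_add_sum_filter_not Finset.univ (fun α : Weight K H L => α.IsNonZero)]
  -- the non-zero roots contribute `1` each
  have hnz : ∑ α ∈ Finset.univ.filter (fun α : Weight K H L => α.IsNonZero), finrank K (rootSpace H α) =
      H.root.card := by
    rw [Finset.card_eq_sum_ones]
    refine Finset.sum_congr rfl fun α hα => ?_
    rw [Finset.mem_filter] at hα
    exact IsKilling.finrank_rootSpace_eq_one α hα.2
  -- the zero weight (if any) contributes `dim H`
  have hz : ∑ α ∈ Finset.univ.filter (fun α : Weight K H L => ¬α.IsNonZero), finrank K (rootSpace H α) =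
      finrank K H := by
    by_cases hex : ∃ α₀ : Weight K H L, α₀.IsZero
    · obtain ⟨α₀, hα₀⟩ := hex
      have hfilt : Finset.univ.filter (fun α : Weight K H L => ¬α.IsNonZero) = {α₀} := by
        ext α
        simp only [Finset.mem_filter, Finset.mem_univ, true_and, Finset.mem_singleton, Weight.IsNonZero, not_not]
        constructor
        · intro hα
          exact Weight.ext fun x => by rw [show (α : H → K) x = (0 : H → K) x by rw [hα.eq],
            show (α₀ : H → K) x = (0 : H → K) x by rw [hα₀.eq]]
        · rintro rfl; exact hα₀
      rw [hfilt, Finset.sum_singleton]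
      have h0 : rootSpace H (α₀ : H → K) = H.toLieSubmodule := by rw [hα₀.eq]; exact rootSpace_zero_eq K L H
      rw [h0]
      rfl
    · have hfilt : Finset.univ.filter (fun α : Weight K H L => ¬α.IsNonZero) = ∅ := by
        ext α
        simp only [Finset.mem_filter, Finset.mem_univ, true_and, Finset.notMem_empty, iff_false, Weight.IsNonZero,
          not_not]
        exact fun hα => hex ⟨α, hα⟩
      rw [hfilt, Finset.sum_empty]
      -- no zero weight: `H = rootSpace H 0 = ⊥`
      have hbot : rootSpace H (0 : H → K) = ⊥ := by
        by_contra hne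
        exact hex ⟨⟨0, hne⟩, rfl⟩
      rw [rootSpace_zero_eq K L H] at hbot
      have hH : H = ⊥ := by
        rw [← LieSubalgebra.toSubmodule_inj, LieSubalgebra.bot_toSubmodule, ← LieSubalgebra.coe_toLieSubmodule, hbot,
          LieSubmodule.bot_toSubmodule]
      rw [hH]
      exact (finrank_bot K L).symm
  rw [hnz, hz, add_comm]

omit [IsAlgClosed K] [LieAlgebra.IsKilling K L] in
/-- If the Cartan subalgebra is `0`, there are no roots. [cite: Humphreys1972, §8.1] -/
theorem card_root_eq_zero_of_finrank_cartan_eq_zero (h : finrank K H = 0) : H.root.card = 0 := by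
  classical
  haveI : Subsingleton H := Module.finrank_zero_iff.1 h
  rw [Finset.card_eq_zero, Finset.eq_empty_iff_forall_notMem]
  intro α hα
  rw [Finset.mem_filter] at hα
  exact hα.2 (funext fun x => by rw [Subsingleton.elim x 0, map_zero]; rfl)

/-- **The number of roots is even**: `α ↦ -α` is a fixed-point-free involution of the roots (`-α ≠ α` in
characteristic `0`). [cite: Humphreys1972, §8.3] -/
theorem even_card_root : Even H.root.card := by
  classical
  -- the involution on the subtype of roots
  let f : Function.End H.root := fun α => ⟨-α.1, by
    have h := α.2; rw [Finset.mem_filter] at h ⊢; exact ⟨Finset.mem_univ _, Weight.IsNonZero.neg h.2⟩⟩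
  have hf2 : f ^ 2 ^ 1 = 1 := by
    funext α
    change f (f α) = α
    exact Subtype.ext (neg_neg α.1)
  haveI : Fact (Nat.Prime 2) := ⟨Nat.prime_two⟩
  have hmod := Equiv.Perm.card_fixedPoints_modEq (f := f) hf2
  have hfix : Fintype.card (Function.fixedPoints f) = 0 := by
    rw [Fintype.card_eq_zero_iff]
    refine ⟨fun ⟨α, hα⟩ => ?_⟩
    have h := α.2; rw [Finset.mem_filter] at h
    have e : -α.1 = α.1 := congrArg Subtype.val hα
    apply h.2
    -- `-α = α` forces `α = 0`
    funext x
    have ex : -(α.1 x) = α.1 x := by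
      have := congrArg (fun β : Weight K H L => (β : H → K) x) e
      simpa using this
    have : (2 : K) * α.1 x = 0 := by rw [two_mul]; nth_rewrite 1 [← ex]; rw [neg_add_cancel]
    simpa using this
  rw [hfix, Fintype.card_coe] at hmod
  exact Nat.even_iff.2 hmod

omit [IsAlgClosed K] in
/-- In a linearly independent subset of a vector space, no element is the negative of an element (characteristic
`≠ 2` suffices; here over a field of characteristic `0`). [folklore] -/
private theorem neg_notMem_of_linearIndepOn {W : Type*} [AddCommGroup W] [Module K W] {b : Set W}
    (hb : LinearIndepOn K id b) {x : W} (hx : x ∈ b) : -x ∉ b := by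
  classical
  intro hnx
  have key : LinearIndependent K (fun y : b => (y : W)) := hb
  by_cases hxx : -x = x
  · -- then `x = 0`, impossible in a linearly independent family
    have hx0 : x = 0 := by
      have : (2 : K) • x = 0 := by rw [two_smul]; nth_rewrite 1 [← hxx]; rw [neg_add_cancel]
      simpa using this
    exact key.ne_zero ⟨x, hx⟩ hx0
  · -- `x + (-x) = 0` is a non-trivial relation between two distinct members of `b`
    have hne : (⟨x, hx⟩ : b) ≠ ⟨-x, hnx⟩ := fun e => hxx (congrArg Subtype.val e).symm
    have h1 := (linearIndependent_iff'.1 key) {⟨x, hx⟩, ⟨-x, hnx⟩} (fun _ => (1 : K))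
      (by rw [Finset.sum_pair hne]; simp) ⟨x, hx⟩ (by simp)
    exact one_ne_zero h1

/-- **`2 · rank ≤ #roots`**: the roots span `H*` (`LieAlgebra.IsKilling.span_weight_isNonZero_eq_top`), so they
contain `dim H` linearly independent ones, and these are disjoint from their negatives, which are roots too.
[cite: Humphreys1972, §8.3] -/
theorem two_mul_finrank_cartan_le_card_root : 2 * finrank K H ≤ H.root.card := by
  classical
  -- the set of roots as linear functionals
  let S : Finset (Module.Dual K H) := H.root.image (Weight.toLinear K H L)
  have hSspan : Submodule.span K (S : Set (Module.Dual K H)) = ⊤ := by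
    rw [← LieAlgebra.IsKilling.span_weight_isNonZero_eq_top K L H, Finset.coe_image]
    congr 1
    ext φ
    simp only [Set.mem_image, Finset.mem_coe, Finset.mem_filter, Finset.mem_univ, true_and, Set.mem_setOf_eq]
  have hSneg : ∀ φ ∈ S, -φ ∈ S := by
    intro φ hφ
    obtain ⟨α, hα, rfl⟩ := Finset.mem_image.1 hφ
    rw [Finset.mem_filter] at hα
    refine Finset.mem_image.2 ⟨-α, ?_, ?_⟩
    · rw [Finset.mem_filter]; exact ⟨Finset.mem_univ _, Weight.IsNonZero.neg hα.2⟩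
    · ext x; simp
  -- a basis of `H*` made of roots
  obtain ⟨b, hbS, hbspan, hblin⟩ := exists_linearIndependent K (S : Set (Module.Dual K H))
  have hbfin : b.Finite := S.finite_toSet.subset hbS
  haveI : Fintype b := hbfin.fintype
  have hblin' : LinearIndepOn K id b := hblin
  have hbcard : b.toFinset.card = finrank K H := by
    rw [← finrank_span_set_eq_card hblin', hbspan, hSspan, finrank_top, Subspace.dual_finrank_eq]
  -- `b ∪ (-b) ⊆ S` has `2 |b|` elements
  let nb : Finset (Module.Dual K H) := b.toFinset.image (fun φ => -φ)
  have hdisj : Disjoint b.toFinset nb := by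
    rw [Finset.disjoint_left]
    intro φ hφ hφ'
    rw [Set.mem_toFinset] at hφ
    obtain ⟨ψ, hψ, rfl⟩ := Finset.mem_image.1 hφ'
    rw [Set.mem_toFinset] at hψ
    exact neg_notMem_of_linearIndepOn hblin' hψ hφ
  have hnbcard : nb.card = b.toFinset.card := Finset.card_image_of_injective _ neg_injective
  have hsub : b.toFinset ∪ nb ⊆ S := by
    intro φ hφ
    rcases Finset.mem_union.1 hφ with h | h
    · exact hbS (Set.mem_toFinset.1 h)
    · obtain ⟨ψ, hψ, rfl⟩ := Finset.mem_image.1 h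
      exact hSneg ψ (hbS (Set.mem_toFinset.1 hψ))
  calc 2 * finrank K H = (b.toFinset ∪ nb).card := by
        rw [Finset.card_union_of_disjoint hdisj, hnbcard, hbcard, two_mul]
    _ ≤ S.card := Finset.card_le_card hsub
    _ ≤ H.root.card := Finset.card_image_le

/-- **In rank one there are exactly two roots `±α`** (`H*` is a line, and the only multiples of a root which are roots
are `±α`, `LieAlgebra.IsKilling.eq_neg_or_eq_of_eq_smul`). [cite: Humphreys1972, §8.4] -/
theorem card_root_eq_two_of_finrank_cartan_eq_one (h : finrank K H = 1) : H.root.card = 2 := by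
  classical
  have h2 := two_mul_finrank_cartan_le_card_root H
  rw [h, mul_one] at h2
  obtain ⟨α₀, hα₀⟩ : H.root.Nonempty := Finset.card_pos.1 (by omega)
  have hα₀' : α₀.IsNonZero := (Finset.mem_filter.1 hα₀).2
  have hne : (-α₀ : Weight K H L) ≠ α₀ := by
    intro e
    apply hα₀'
    funext x
    have ex : -(α₀ x) = α₀ x := by
      have := congrArg (fun β : Weight K H L => (β : H → K) x) e
      simpa using this
    have : (2 : K) * α₀ x = 0 := by rw [two_mul]; nth_rewrite 1 [← ex]; rw [neg_add_cancel]
    simpa using this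
  -- every root is `±α₀`
  have hdual : finrank K (Module.Dual K H) = 1 := by rw [Subspace.dual_finrank_eq, h]
  have hα₀L : (Weight.toLinear K H L α₀) ≠ 0 := (Weight.coe_toLinear_ne_zero_iff).2 hα₀'
  have hall : ∀ β ∈ H.root, β = -α₀ ∨ β = α₀ := by
    intro β hβ
    have hβ' : β.IsNonZero := (Finset.mem_filter.1 hβ).2
    obtain ⟨c, hc⟩ := (finrank_eq_one_iff_of_nonzero' _ hα₀L).1 hdual (Weight.toLinear K H L β)
    refine LieAlgebra.IsKilling.eq_neg_or_eq_of_eq_smul α₀ β hβ' c ?_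
    ext x
    have := LinearMap.congr_fun hc x
    simpa using this.symm
  have hsub : H.root ⊆ {-α₀, α₀} := fun β hβ => by
    rcases hall β hβ with rfl | rfl <;> simp
  have hsup : {-α₀, α₀} ⊆ H.root := by
    intro β hβ
    rcases Finset.mem_insert.1 hβ with rfl | hβ
    · exact Finset.mem_filter.2 ⟨Finset.mem_univ _, Weight.IsNonZero.neg hα₀'⟩
    · rw [Finset.mem_singleton] at hβ; rw [hβ]; exact hα₀
  rw [Finset.Subset.antisymm hsub hsup, Finset.card_pair hne]

end AlgClosed

/-! ### §2 The small-dimension table -/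

section Table

/-- The arithmetic of the table: if `d = r + N` with `N` even, `2r ≤ N`, `r = 0 ⟹ N = 0` and `r = 1 ⟹ N = 2`, then
`d ∉ {1, 2, 4, 5, 7}`. [folklore] -/
private theorem table_arith {d r N : ℕ} (hd : d = r + N) (heven : Even N) (h2 : 2 * r ≤ N) (h0 : r = 0 → N = 0)
    (h1 : r = 1 → N = 2) : d ≠ 1 ∧ d ≠ 2 ∧ d ≠ 4 ∧ d ≠ 5 ∧ d ≠ 7 := by
  obtain ⟨k, rfl⟩ := heven
  refine ⟨?_, ?_, ?_, ?_, ?_⟩ <;> intro h <;> subst hd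
  · omega
  · rcases Nat.eq_zero_or_pos r with hr | hr
    · have := h0 hr; omega
    · omega
  · rcases Nat.eq_zero_or_pos r with hr | hr
    · have := h0 hr; omega
    · by_cases hr1 : r = 1
      · have := h1 hr1; omega
      · omega
  · by_cases hr1 : r = 1
    · have := h1 hr1; omega
    · rcases Nat.eq_zero_or_pos r with hr | hr
      · have := h0 hr; omega
      · omega
  · by_cases hr1 : r = 1
    · have := h1 hr1; omega
    · rcases Nat.eq_zero_or_pos r with hr | hr
      · have := h0 hr; omega
      · omega

variable {K L : Type*} [Field K] [CharZero K] [LieRing L] [LieAlgebra K L] [FiniteDimensional K L]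

/-- **A finite-dimensional Lie algebra with non-degenerate Killing form over an algebraically closed field of
characteristic `0` has dimension `∉ {1, 2, 4, 5, 7}`** (`dim = rank + #roots`, `#roots` even, `≥ 2·rank`, `= 2` in
rank one, `= 0` in rank zero). [cite: Humphreys1972, §8.4] -/
theorem finrank_ne_of_isKilling_of_isAlgClosed [IsAlgClosed K] [LieAlgebra.IsKilling K L] :
    finrank K L ≠ 1 ∧ finrank K L ≠ 2 ∧ finrank K L ≠ 4 ∧ finrank K L ≠ 5 ∧ finrank K L ≠ 7 := by
  obtain ⟨x, hx⟩ := LieAlgebra.exists_isCartanSubalgebra_engel K L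
  haveI := hx
  exact table_arith (finrank_eq_finrank_cartan_add_card_root (LieSubalgebra.engel K x))
    (even_card_root (LieSubalgebra.engel K x)) (two_mul_finrank_cartan_le_card_root (LieSubalgebra.engel K x))
    (card_root_eq_zero_of_finrank_cartan_eq_zero (LieSubalgebra.engel K x))
    (card_root_eq_two_of_finrank_cartan_eq_one (LieSubalgebra.engel K x))

/-- **The same over any field of characteristic `0`** (base change to the algebraic closure preserves the dimension and
the non-degeneracy of the Killing form, `KillingBaseChange.isKilling_baseChange`). [cite: Humphreys1972, §8.4] -/
theorem finrank_ne_of_isKilling [LieAlgebra.IsKilling K L] :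
    finrank K L ≠ 1 ∧ finrank K L ≠ 2 ∧ finrank K L ≠ 4 ∧ finrank K L ≠ 5 ∧ finrank K L ≠ 7 := by
  haveI : LieAlgebra.IsKilling (AlgebraicClosure K) (AlgebraicClosure K ⊗[K] L) :=
    KillingBaseChange.isKilling_baseChange
  have h := finrank_ne_of_isKilling_of_isAlgClosed (K := AlgebraicClosure K) (L := AlgebraicClosure K ⊗[K] L)
  rwa [Module.finrank_baseChange] at h

/-- **A semisimple (trivial radical) finite-dimensional Lie algebra over a field of characteristic `0` has dimension
`∉ {1, 2, 4, 5, 7}`** (Cartan's criterion `LieAlgebra.HasTrivialRadical.instIsKilling`). [cite: Humphreys1972, §8.4]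
[cite: Humphreys1972, §5.1] -/
theorem finrank_ne_of_hasTrivialRadical [LieAlgebra.HasTrivialRadical K L] :
    finrank K L ≠ 1 ∧ finrank K L ≠ 2 ∧ finrank K L ≠ 4 ∧ finrank K L ≠ 5 ∧ finrank K L ≠ 7 :=
  finrank_ne_of_isKilling

/-- **A non-zero semisimple Lie algebra has dimension at least `3`; if its dimension is not `3` it is at least `6`.**
[cite: Humphreys1972, §8.4] -/
theorem three_le_finrank_of_hasTrivialRadical [LieAlgebra.HasTrivialRadical K L] [Nontrivial L] :
    3 ≤ finrank K L ∧ (finrank K L ≠ 3 → 6 ≤ finrank K L) := by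
  have h := finrank_ne_of_hasTrivialRadical (K := K) (L := L)
  have h0 : 0 < finrank K L := finrank_pos
  omega

end Table

end SemisimpleSmallDimension

end Literature.Algebra.Lie
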